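import Literature.Probability.RandomPlanarGeometry.SAWCountMonotoneBothTrappedOdd
import Literature.Probability.RandomPlanarGeometry.SAWCountMonotoneEscapeEven
import Literature.Probability.RandomPlanarGeometry.SAWCountMonotoneEscapeSharp
import Literature.Probability.RandomPlanarGeometry.SAWCountMonotoneEscapeSharpEven
import HarnessLib

/-!
# Monotonicity `cₙ ≤ cₙ₊₁` (O'Brien 1990) for every ODD `n ≤ 6d - 3`, hence for ALL `n ≤ 6d - 2`, in
# every dimension: the escape residual is empty there (rays from the pocket)

Sequel of `SAWCountMonotoneEscapeEven.lean` (`R(d, n) = ∅` for even `n ≤ 8d - 6` by straight-ray blocking)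
and of `SAWCountMonotoneBothTrappedOdd.lean` (no walk trapped at both ends at an odd `n ≤ 6d - 3`).
Here the pocketed class is excluded at the odd lengths as well, which closes the **escape-residual
threshold law** in every dimension `d ≥ 2`:

  `R(d, n) = ∅ ⟺ (n odd ∧ n ≤ 6d - 3) ∨ (n even ∧ n ≤ 8d - 6)`

(`escapeResidual_eq_empty_iff`; the nonempty halves are `SAWCountMonotoneEscapeSharp.lean` and
`SAWCountMonotoneEscapeSharpEven.lean`), and with it O'Brien's inequality `cₙ ≤ cₙ₊₁` by the escape
route `count_le_count_succ_of_escapeResidual_eq_empty` for **all `n ≤ 6d - 2`** and all even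
`n ≤ 8d - 6`, in every dimension — two steps beyond the reversal route (`n ≤ 6d - 4`, even `n ≤ 8d - 8`).

The argument (`n` odd, `n ≤ 6d - 3`, `ω ∈ R(d, n)`, `e = ω n`; `(n+1)/2 ≤ 3d - 1` sites of each parity;
odd sites `O ⊇ N(0) ∪ {e}`, spare ones `S₁`; even sites `E ⊇ {0} ∪ A`, `A` the `2d - a` visited
neighbours of `e`, spare ones `S₀`):
* START CAGE (`two_mul_le_card_exceptional_of_surrounded`, the count of
  `bothTrapped_eq_empty_of_odd` with its antipode slack): the `2d` odd times next to `0` force at least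
  `d - 1` (at least `d` when `e ∼ 0`) spare even sites of norm two — NEAR sites, useless as far witnesses.
* RAYS FROM THE END: by `SAWCountMonotoneBothTrappedOdd.lean`, `a ≥ 1`.  Choose the pocket site `y`
  to be the (at most one, `‖e‖₁` being odd) COSTLESS free direction if there is one; every other free
  direction is costly and hands over a distinct spare ODD site, none of them adjacent to `y`
  (`exists_ray_blocker`, `ray_witness_separate`): `(a - 1) + k₁ ≤ s₁`, `k₁` = visited neighbours of
  `y` outside the cages.
* RAYS FROM THE POCKET (`exists_free_ray_blocker`): every free neighbour `z = y + u` of `y` has its ray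
  `y + t u`, `t ≥ 2`, blocked; a Y-COSTLY direction (all ray points of norm `≥ 4`) hands over a distinct
  FAR spare even site (norm `≥ 3`, not a neighbour of `e`): the blocker itself (`t` even) or its
  successor on the walk (`t` odd); Y-COSTLESS directions are inward along a coordinate with
  `|yᵢ| ≥ max (2, ‖y‖₁ - 3)`: at most two, none when `‖y‖₁ = 2`.
* COUNT: the `2d - 1` neighbours of `y` other than `e` are free (`f`), in `N(0)` (`κ ≤ 2`, `≤ 1` if
  `e ∼ 0`, `0` if `‖y‖₁ ≥ 4`) or in `S₁` (`k₁`); `f ≤ #Y-costless + #far ≤ #Y-costless + s₀ - #near`;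
  with `2 s₁ ≤ n + 1 - 4d - 2[e ≁ 0]` and `2 s₀ ≤ n + 1 - 4d + 2a - 2[e ≁ 0]` every case is short by
  `7d - 4 - n`, so pockets need `n ≥ 7d - 4` (and, this being the point, `R = ∅` for odd `n ≤ 6d - 3`).

* `endFree_of_free_ray`, `exists_free_ray_blocker` : rays out of a free neighbour of the end;
* `exists_normOne_eq_sum_add_two_mul` : `‖x‖₁ ≡ Σ xᵢ (mod 2)`;
* `two_mul_le_card_exceptional_of_surrounded` : the start-cage lemma (`2d ≤ 2 #X' + 1`);
* `exists_single_of_ray`, `natAbs_add_natAbs_le_normOne` : coordinates along a ray;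
* `extCount_eq_zero_of_mem_escapeResidual_of_odd` : for `d ≥ 2` and odd `n ≤ 7d - 5` every residual
  walk is trapped at both ends (no pocketed class);
* `escapeResidual_eq_empty_of_odd` : **`R(d, n) = ∅` for `d ≥ 2`, `n` odd, `n + 3 ≤ 6d`**;
* `count_le_count_succ_of_odd_le` : `cₙ ≤ cₙ₊₁` for odd `n ≤ 6d - 3` (`d = 3`: `n = 15`; `d = 4`: `n = 21`);
* `count_le_count_succ_of_le_six_mul_sub_two` : **`cₙ ≤ cₙ₊₁` for ALL `n ≤ 6d - 2`, every `d ≥ 1`**;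
* `escapeResidual_eq_empty_iff`, `escapeResidual_nonempty_iff` : **the threshold law of the escape
  residual** (`d ≥ 2`).

Exhaustive enumeration (lane «pcv-sawmu» a-p4 g26, kit j306921 / j307755 / j307756; not used in any
proof) agrees: `R(2, 9) = ∅`, `R(3, 15) = ∅`, `R(4, 21) = ∅`, and `R(2, 11)`, `R(3, 17)`, `R(3, 19)`
nonempty.  The escape route, the rays and the counts are a lane construction; the vocabulary is
Madras–Slade §1.1–1.2; the general inequality is O'Brien's theorem, the tree's named fact
`BDGS2012_count_mono`.

[cite: MadrasSlade1993, §1.1; §1.2 (p. 10: parity); §7.1 p. 231 (`c_{N+1} ≥ c_N`, O'Brien)]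
[cite: BDGS2012, §1.1, eq. (1.1) (`‖x‖₁`); §1.3 (`cₙ ≤ cₙ₊₁`, O'Brien 1990)]
-/

noncomputable section

open Literature.Probability.LatticeModels Literature.Probability.Percolation SimpleGraph

namespace Literature.Probability.RandomPlanarGeometry.SAW.Zd

variable {d : ℕ}

/-! ### Rays from a free site -/

/-- **A free ray from a free neighbour is an escape route**: if `y` is a free neighbour of the end,
`y ∼ y + u`, and no site `y + t u`, `t ≥ 1`, is on the walk, then `k ↦ y + k u` escapes.
[cite: MadrasSlade1993, §1.1] -/
theorem endFree_of_free_ray {ω : ℕ → Site d} {n : ℕ} {y u : Site d} (hy : y ∈ freeNbrs ω n)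
    (hu : (zdGraph d).Adj y (y + u))
    (hray : ∀ t : ℕ, 1 ≤ t → ∀ i ≤ n, ω i ≠ y + (t : ℤ) • u) : EndFree ω n := by
  obtain ⟨hadj, hfree⟩ := mem_freeNbrs.1 hy
  have hu0 : u ≠ 0 := fun h => hu.ne (by rw [h, add_zero])
  refine ⟨fun k => y + (k : ℤ) • u, ?_, ?_, ?_, ?_⟩
  · show (zdGraph d).Adj (ω n) (y + ((0 : ℕ) : ℤ) • u)
    simpa using hadj
  · intro k
    have h := (zdGraph_adj_add_right y (y + u) ((k : ℤ) • u)).2 hu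
    have e1 : y + u + (k : ℤ) • u = y + ((k + 1 : ℕ) : ℤ) • u := by push_cast; module
    rwa [e1] at h
  · intro k k' h
    have h1 : (k : ℤ) • u = (k' : ℤ) • u := add_left_cancel h
    rw [← sub_eq_zero, ← sub_smul, smul_eq_zero] at h1
    rcases h1 with h1 | h1
    · exact_mod_cast (show (k : ℤ) = k' by linarith)
    · exact absurd h1 hu0
  · intro k j hj h
    rcases Nat.eq_zero_or_pos k with rfl | hk
    · refine hfree j hj ?_
      rw [← h]; simp
    · exact hray k hk j hj h.symm

/-- **A doomed end blocks every ray out of a free neighbour**: if the end of `ω` is not free, `y` is a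
free neighbour of `e = ω n` and `y + u ∼ y` is not on the walk either, then some `y + t u`, `t ≥ 2`, is.
[cite: MadrasSlade1993, §1.1] -/
theorem exists_free_ray_blocker {ω : ℕ → Site d} {n : ℕ} {y u : Site d} (hdoom : ¬ EndFree ω n)
    (hy : y ∈ freeNbrs ω n) (hu : (zdGraph d).Adj y (y + u)) (hfree : ∀ i ≤ n, ω i ≠ y + u) :
    ∃ t : ℕ, 2 ≤ t ∧ ∃ i ≤ n, ω i = y + (t : ℤ) • u := by
  by_contra h
  push Not at h
  refine hdoom (endFree_of_free_ray hy hu fun t ht i hi hi' => ?_)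
  rcases Nat.lt_or_ge t 2 with h2 | h2
  · have : t = 1 := by omega
    subst this
    exact hfree i hi (by simpa using hi')
  · exact h t h2 i hi hi'

/-- The `ℓ¹`-norm has the parity of the coordinate sum. [cite: BDGS2012, §1.1, eq. (1.1)] -/
theorem exists_normOne_eq_sum_add_two_mul (x : Site d) :
    ∃ m : ℤ, (normOne x : ℤ) = (∑ k, x k) + 2 * m := by
  classical
  unfold normOne
  push_cast
  induction (Finset.univ : Finset (Fin d)) using Finset.induction_on with
  | empty => exact ⟨0, by simp⟩
  | insert a s ha ih =>
    obtain ⟨m, hm⟩ := ih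
    rw [Finset.sum_insert ha, Finset.sum_insert ha, hm]
    rcases le_or_gt 0 (x a) with h | h
    · exact ⟨m, by rw [abs_of_nonneg h]; ring⟩
    · exact ⟨m - x a, by rw [abs_of_neg h]; ring⟩

open Classical in
/-- **The start-cage lemma.**  If `n` is odd and the start of the `n`-step self-avoiding walk `ω` is
completely surrounded (`extCount (revWalk n ω) n = 0`), then the even times `i < n` whose site is NOT
adjacent to the end `ω n` and has `ℓ¹`-norm `0` or `2` — the *exceptional times next to the start's cage* —
number at least `d`: precisely `2d ≤ 2 #X' + 1`.  (The `2d` odd times at which the start's neighbours are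
visited are generic, final or special as in `bothTrapped_eq_empty_of_odd`; generic-or-final ones are at
most two, every special one sits next to such an exceptional time, each exceptional time serves at most
two special times, and one unit of slack comes from the time `0` when `ω n ≁ 0`, from the visit of the
antipode `-ω n` when `ω n ∼ 0`.) [cite: MadrasSlade1993, §1.2, p. 10; §7.1] [cite: BDGS2012, §1.3] -/
theorem two_mul_le_card_exceptional_of_surrounded {n : ℕ} {ω : ℕ → Site d} (hω : ω ∈ saws d n)
    (hodd : Odd n) (h1 : extCount (revWalk n ω) n = 0) :
    2 * d ≤ 2 * (((Finset.range n).filter fun i => i % 2 = 0).filter fun i =>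
      ¬ (zdGraph d).Adj (ω n) (ω i) ∧ (normOne (ω i) = 0 ∨ normOne (ω i) = 2)).card + 1 := by
  classical
  obtain ⟨h00, -, hadj, hinj⟩ := mem_saws.1 hω
  have hn2 : n % 2 = 1 := Nat.odd_iff.1 hodd
  have hinj' : ∀ i ≤ n, ∀ j ≤ n, ω i = ω j → i = j := fun i hi j hj h =>
    hinj (show i ∈ {i | i ≤ n} from hi) (show j ∈ {i | i ≤ n} from hj) h
  -- even times `< n` and the exceptional times `X` next to the start's cage
  set P := (Finset.range n).filter fun i => i % 2 = 0 with hP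
  set X := P.filter fun i => ¬ (zdGraph d).Adj (ω n) (ω i) ∧
    (normOne (ω i) = 0 ∨ normOne (ω i) = 2) with hX
  -- the visited neighbours of the start (all of them) and their (odd) times `B`
  set U := (nbrs (ω 0)).filter fun z => ∀ i ≤ n, ω i ≠ z with hU
  set W := (nbrs (ω 0)).filter fun z => ¬ ∀ i ≤ n, ω i ≠ z with hW
  have hUW : U.card + W.card = 2 * d := by
    rw [hU, hW, Finset.card_filter_add_card_filter_not, card_nbrs]
  have hU0 : U.card ≤ 0 := (card_filter_nbrs_start_le_extCount_revWalk hω).trans h1.le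
  have hvis0 : ∀ z, (zdGraph d).Adj (ω 0) z → ∃ i ≤ n, ω i = z := fun z hz => by
    by_contra h
    have : 0 < U.card :=
      Finset.card_pos.2 ⟨z, Finset.mem_filter.2 ⟨mem_nbrs.2 hz, fun i hi hiz => h ⟨i, hi, hiz⟩⟩⟩
    omega
  set B := (Finset.range (n + 1)).filter fun j => (zdGraph d).Adj (ω 0) (ω j) with hB
  have hBmem : ∀ j ∈ B, j ≤ n ∧ j % 2 = 1 ∧ (zdGraph d).Adj (ω 0) (ω j) := by
    intro j hj
    rw [hB, Finset.mem_filter, Finset.mem_range] at hj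
    have hpar := odd_add_of_adj_apply_apply hω (Nat.zero_le n) (by omega : j ≤ n) hj.2
    exact ⟨by omega, by omega, hj.2⟩
  have hWB : W.card ≤ B.card := by
    have hsub : W ⊆ B.image ω := by
      intro z hz
      rw [hW, Finset.mem_filter] at hz
      obtain ⟨hz, hvis⟩ := hz
      have hex : ∃ i ≤ n, ω i = z := by
        by_contra h; exact hvis fun i hi hiz => h ⟨i, hi, hiz⟩
      obtain ⟨j, hj, rfl⟩ := hex
      refine Finset.mem_image.2 ⟨j, ?_, rfl⟩
      rw [hB, Finset.mem_filter, Finset.mem_range]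
      exact ⟨by omega, mem_nbrs.1 hz⟩
    exact (Finset.card_le_card hsub).trans Finset.card_image_le
  -- split `B`: the final time `n`, generic times, special times
  set Bf := B.filter fun j => ¬ j < n with hBf
  set Bl := B.filter fun j => j < n with hBl
  have hBsplit : Bl.card + Bf.card = B.card := by
    rw [hBl, hBf, Finset.card_filter_add_card_filter_not]
  set G := Bl.filter fun j => (zdGraph d).Adj (ω n) (ω (j - 1)) ∧ (zdGraph d).Adj (ω n) (ω (j + 1))
    with hG
  set Sp := Bl.filter fun j =>
    ¬ ((zdGraph d).Adj (ω n) (ω (j - 1)) ∧ (zdGraph d).Adj (ω n) (ω (j + 1))) with hSp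
  have hBlsplit : G.card + Sp.card = Bl.card := by
    rw [hG, hSp, Finset.card_filter_add_card_filter_not]
  -- special times sit next to exceptional even times: at most `2 #X` of them
  set Sp₁ := Bl.filter fun j => ¬ (zdGraph d).Adj (ω n) (ω (j - 1)) with hSp₁
  set Sp₂ := Bl.filter fun j => ¬ (zdGraph d).Adj (ω n) (ω (j + 1)) with hSp₂
  have hBlmem : ∀ j ∈ Bl, j < n ∧ j % 2 = 1 ∧ (zdGraph d).Adj (ω 0) (ω j) := by
    intro j hj
    rw [hBl, Finset.mem_filter] at hj
    obtain ⟨-, hpar, ha⟩ := hBmem j hj.1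
    exact ⟨hj.2, hpar, ha⟩
  have hSpsub : Sp ⊆ Sp₁ ∪ Sp₂ := by
    intro j hj
    rw [hSp, Finset.mem_filter, not_and_or] at hj
    rcases hj.2 with h | h
    · exact Finset.mem_union_left _ (Finset.mem_filter.2 ⟨hj.1, h⟩)
    · exact Finset.mem_union_right _ (Finset.mem_filter.2 ⟨hj.1, h⟩)
  have hSpU : Sp.card + (Sp₁ ∩ Sp₂).card ≤ Sp₁.card + Sp₂.card := by
    have := Finset.card_le_card hSpsub
    have := Finset.card_union_add_card_inter Sp₁ Sp₂
    omega
  -- the sites next to a neighbour of the start have norm `0` or `2`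
  have hnorm2 : ∀ j ∈ Bl, ∀ i ≤ n, (zdGraph d).Adj (ω i) (ω j) →
      normOne (ω i) = 0 ∨ normOne (ω i) = 2 := by
    intro j hj i hi hij
    have h1 : normOne (ω j) = 1 := adj_zero_iff_normOne_eq_one.1 (h00 ▸ (hBlmem j hj).2.2)
    rcases normOne_adj_cases hij.symm with h | h <;> omega
  have hSp₁X : Sp₁.card ≤ X.card := by
    refine Finset.card_le_card_of_injOn (fun j => j - 1) (fun j hj => ?_) ?_
    · rw [Finset.mem_coe, hSp₁, Finset.mem_filter] at hj
      obtain ⟨hjn, hpar, -⟩ := hBlmem j hj.1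
      have hstep : (zdGraph d).Adj (ω (j - 1)) (ω j) := by
        have := hadj (j - 1) (by omega); rwa [show j - 1 + 1 = j by omega] at this
      show j - 1 ∈ (X : Set ℕ)
      rw [Finset.mem_coe, hX, Finset.mem_filter, hP, Finset.mem_filter, Finset.mem_range]
      exact ⟨⟨by omega, by omega⟩, hj.2, hnorm2 j hj.1 (j - 1) (by omega) hstep⟩
    · intro j hj j' hj' h
      rw [Finset.mem_coe, hSp₁, Finset.mem_filter] at hj hj'
      have := (hBlmem j hj.1).2.1
      have := (hBlmem j' hj'.1).2.1
      simp only at h; omega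
  have hSp₂X : Sp₂.card ≤ (X.erase 0).card := by
    refine Finset.card_le_card_of_injOn (fun j => j + 1) (fun j hj => ?_) ?_
    · rw [Finset.mem_coe, hSp₂, Finset.mem_filter] at hj
      obtain ⟨hjn, hpar, -⟩ := hBlmem j hj.1
      have hstep : (zdGraph d).Adj (ω (j + 1)) (ω j) := (hadj j (by omega)).symm
      show j + 1 ∈ ((X.erase 0 : Finset ℕ) : Set ℕ)
      rw [Finset.mem_coe, Finset.mem_erase, hX, Finset.mem_filter, hP, Finset.mem_filter,
        Finset.mem_range]
      exact ⟨by omega, ⟨by omega, by omega⟩, hj.2, hnorm2 j hj.1 (j + 1) (by omega) hstep⟩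
    · intro j _ j' _ h
      simpa using h
  -- generic times (and the final time when `ω n ∼ 0`)
  have hGmem : ∀ j ∈ G, j < n ∧ j % 2 = 1 ∧ (zdGraph d).Adj (ω 0) (ω j) ∧
      (zdGraph d).Adj (ω n) (ω (j - 1)) ∧ (zdGraph d).Adj (ω n) (ω (j + 1)) := by
    intro j hj
    rw [hG, Finset.mem_filter] at hj
    obtain ⟨hjn, hpar, ha⟩ := hBlmem j hj.1
    exact ⟨hjn, hpar, ha, hj.2.1, hj.2.2⟩
  have hBf1 : Bf.card ≤ 1 := by
    refine (Finset.card_le_card fun j hj => ?_).trans (Finset.card_singleton n).le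
    rw [hBf, Finset.mem_filter] at hj
    have := (hBmem j hj.1).1
    exact Finset.mem_singleton.2 (by omega)
  by_cases h0n : (zdGraph d).Adj (ω 0) (ω n)
  · -- `e ∼ 0`: the only possible generic time is `j = 1`
    have hG1 : ∀ j ∈ G, j = 1 := by
      intro j hj
      obtain ⟨hjn, hpar, ha, hm, hp⟩ := hGmem j hj
      obtain ⟨k, rfl⟩ : ∃ k, j = k + 1 := ⟨j - 1, by omega⟩
      simp only [Nat.add_sub_cancel] at hm
      by_contra hk1
      have hxy : ω n ≠ ω (k + 1) := fun h => by
        have := hinj' n le_rfl (k + 1) (by omega) h; omega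
      have hzk : (zdGraph d).Adj (ω k) (ω (k + 1)) := hadj k (by omega)
      have hzk2 : (zdGraph d).Adj (ω (k + 1 + 1)) (ω (k + 1)) := (hadj (k + 1) (by omega)).symm
      rcases eq_or_eq_of_adj_adj hxy h0n.symm ha hm hzk with h | h
      · have := hinj' k (by omega) 0 (Nat.zero_le n) h; omega
      rcases eq_or_eq_of_adj_adj hxy h0n.symm ha hp hzk2 with h' | h'
      · have := hinj' (k + 1 + 1) (by omega) 0 (Nat.zero_le n) h'; omega
      · have := hinj' k (by omega) (k + 1 + 1) (by omega) (h.trans h'.symm); omega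
    have hGcard : G.card ≤ 1 :=
      (Finset.card_le_card fun j hj => Finset.mem_singleton.2 (hG1 j hj)).trans
        (Finset.card_singleton 1).le
    -- the antipode `-e` of the end is a visited neighbour of the start, at an odd time `j₀ < n`
    have he : (zdGraph d).Adj 0 (ω n) := h00 ▸ h0n
    have hnege : (zdGraph d).Adj (ω 0) (-ω n) := by
      rw [h00]; exact adj_zero_neg_of_adj_zero he
    obtain ⟨j₀, hj₀n, hj₀⟩ := hvis0 _ hnege
    have hj₀B : j₀ ∈ B := by
      rw [hB, Finset.mem_filter, Finset.mem_range]
      exact ⟨by omega, by rw [hj₀]; exact hnege⟩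
    obtain ⟨-, hj₀par, -⟩ := hBmem j₀ hj₀B
    have hj₀lt : j₀ < n := by
      rcases Nat.lt_or_ge j₀ n with h | h
      · exact h
      · exfalso
        have hjn : j₀ = n := by omega
        rw [hjn] at hj₀
        exact ne_neg_of_adj_zero he hj₀
    have hj₀Bl : j₀ ∈ Bl := Finset.mem_filter.2 ⟨hj₀B, hj₀lt⟩
    -- a time next to `j₀` whose site is adjacent to `e` carries the origin
    have hzero : ∀ i ≤ n, (zdGraph d).Adj (ω n) (ω i) → (zdGraph d).Adj (ω i) (ω j₀) → i = 0 := by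
      intro i hi h1 h2
      have : ω i = 0 := eq_zero_of_adj_of_adj_neg he h1 (by rw [← hj₀]; exact h2)
      exact hinj' i hi 0 (Nat.zero_le n) (this.trans h00.symm)
    have hj₀G : j₀ ∉ G := by
      intro hj
      obtain ⟨-, -, -, hm, hp⟩ := hGmem j₀ hj
      have h1 : j₀ - 1 = 0 := hzero (j₀ - 1) (by omega) hm (by
        have := hadj (j₀ - 1) (by omega)
        rwa [show j₀ - 1 + 1 = j₀ by omega] at this)
      have h2 : j₀ + 1 = 0 := hzero (j₀ + 1) (by omega) hp (hadj j₀ (by omega)).symm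
      omega
    have hj₀Sp : j₀ ∈ Sp := by
      rw [hSp, Finset.mem_filter]
      refine ⟨hj₀Bl, fun h => hj₀G ?_⟩
      rw [hG, Finset.mem_filter]
      exact ⟨hj₀Bl, h⟩
    -- the slack
    have hkey : B.card + 1 ≤ 2 + 2 * X.card := by
      by_cases hs₁ : (zdGraph d).Adj (ω n) (ω (j₀ - 1))
      · -- then `ω (j₀ - 1) = 0`, `j₀ = 1`, and the time `1` is special, not generic: `G = ∅`
        have h1 : j₀ - 1 = 0 := hzero (j₀ - 1) (by omega) hs₁ (by
          have := hadj (j₀ - 1) (by omega)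
          rwa [show j₀ - 1 + 1 = j₀ by omega] at this)
        have hj₀1 : j₀ = 1 := by omega
        have hG0 : G.card = 0 := by
          rw [Finset.card_eq_zero, Finset.eq_empty_iff_forall_notMem]
          intro j hj
          have := hG1 j hj
          rw [this, ← hj₀1] at hj
          exact hj₀G hj
        have := Finset.card_erase_le (s := X) (a := 0)
        omega
      · by_cases hs₂ : (zdGraph d).Adj (ω n) (ω (j₀ + 1))
        · -- then `ω (j₀ + 1) = 0`: impossible
          exfalso
          have := hzero (j₀ + 1) (by omega) hs₂ (hadj j₀ (by omega)).symm
          omega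
        · -- both even neighbours of `j₀` are exceptional: `j₀ ∈ Sp₁ ∩ Sp₂`
          have hmem : j₀ ∈ Sp₁ ∩ Sp₂ :=
            Finset.mem_inter.2 ⟨Finset.mem_filter.2 ⟨hj₀Bl, hs₁⟩, Finset.mem_filter.2 ⟨hj₀Bl, hs₂⟩⟩
          have hpos : 1 ≤ (Sp₁ ∩ Sp₂).card := Finset.card_pos.2 ⟨j₀, hmem⟩
          have := Finset.card_erase_le (s := X) (a := 0)
          omega
    omega
  · -- `e ≁ 0`: no final time, at most two generic times, and the time `0` is exceptional
    have hBf0 : Bf.card = 0 := by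
      rw [Finset.card_eq_zero, Finset.eq_empty_iff_forall_notMem]
      intro j hj
      rw [hBf, Finset.mem_filter] at hj
      obtain ⟨hjle, -, ha⟩ := hBmem j hj.1
      have : j = n := by omega
      subst this
      exact h0n ha
    have hne0 : ω n ≠ 0 := fun h => by
      have := hinj' n le_rfl 0 (Nat.zero_le n) (h.trans h00.symm); omega
    have he2 : 2 ≤ normOne (ω n) := by
      by_contra hlt
      rcases Nat.lt_or_ge (normOne (ω n)) 1 with h | h
      · exact hne0 (normOne_eq_zero_iff.1 (by omega))
      · exact h0n (by rw [h00]; exact adj_zero_iff_normOne_eq_one.2 (by omega))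
    have h0X : 0 ∈ X := by
      rw [hX, Finset.mem_filter, hP, Finset.mem_filter, Finset.mem_range]
      refine ⟨⟨by omega, by omega⟩, fun h => h0n h.symm, Or.inl ?_⟩
      rw [h00, normOne_zero]
    have hXe : (X.erase 0).card + 1 = X.card := Finset.card_erase_add_one h0X
    set Q := (nbrs (ω n)).filter fun x => normOne x ≤ 2 with hQ
    have hQ3 : Q.card ≤ 3 := card_filter_nbrs_normOne_le_two_le he2
    have hnormj : ∀ j ∈ G, normOne (ω j) = 1 := by
      intro j hj
      exact adj_zero_iff_normOne_eq_one.1 (h00 ▸ (hGmem j hj).2.2.1)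
    have hQmem : ∀ j ∈ G, ω (j - 1) ∈ Q ∧ ω (j + 1) ∈ Q := by
      intro j hj
      obtain ⟨hjn, hpar, ha, hm, hp⟩ := hGmem j hj
      have h1 := hnormj j hj
      obtain ⟨k, rfl⟩ : ∃ k, j = k + 1 := ⟨j - 1, by omega⟩
      simp only [Nat.add_sub_cancel] at hm ⊢
      have hsm := normOne_adj_cases ((hadj k (by omega)).symm)
      have hsp := normOne_adj_cases (hadj (k + 1) (by omega))
      exact ⟨Finset.mem_filter.2 ⟨mem_nbrs.2 hm, by omega⟩,
        Finset.mem_filter.2 ⟨mem_nbrs.2 hp, by omega⟩⟩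
    have hG2 : G.card ≤ 2 := by
      rcases G.eq_empty_or_nonempty with hGe | hGne
      · rw [hGe]; simp
      set j₀ := G.min' hGne with hj₀
      have hj₀mem : j₀ ∈ G := Finset.min'_mem G hGne
      have hj₀le : ∀ j ∈ G, j₀ ≤ j := fun j hj => Finset.min'_le G j hj
      set S := insert (ω (j₀ - 1)) (G.image fun j => ω (j + 1)) with hS
      have hSQ : S ⊆ Q := by
        intro x hx
        rw [hS, Finset.mem_insert] at hx
        rcases hx with rfl | hx
        · exact (hQmem j₀ hj₀mem).1
        · obtain ⟨j, hj, rfl⟩ := Finset.mem_image.1 hx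
          exact (hQmem j hj).2
      have hnot : ω (j₀ - 1) ∉ G.image fun j => ω (j + 1) := by
        intro hx
        obtain ⟨j, hj, hjx⟩ := Finset.mem_image.1 hx
        have hjn := (hGmem j hj).1
        have hj0n := (hGmem j₀ hj₀mem).1
        have := hinj' (j + 1) (by omega) (j₀ - 1) (by omega) hjx
        have := hj₀le j hj
        omega
      have hScard : S.card = G.card + 1 := by
        rw [hS, Finset.card_insert_of_notMem hnot, Finset.card_image_of_injOn]
        intro j hj j' hj' h
        rw [Finset.mem_coe] at hj hj'
        have := hinj' (j + 1) (by have := (hGmem j hj).1; omega) (j' + 1)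
          (by have := (hGmem j' hj').1; omega) h
        simpa using this
      have := Finset.card_le_card hSQ
      omega
    omega


/-- **Coordinates along a ray.**  For a lattice step `u = σ eᵢ` at `p`: the ray point `p + t u` and the
neighbour `p + u` agree with `p` off `i`, so `‖p + t u‖₁ + |pᵢ| = ‖p‖₁ + |pᵢ + t σ|` and
`‖p + u‖₁ + |pᵢ| = ‖p‖₁ + |pᵢ + σ|`. [cite: BDGS2012, §1.1, eq. (1.1)] -/
theorem exists_single_of_ray {p u : Site d} (hu : (zdGraph d).Adj p (p + u)) (t : ℕ) :
    ∃ i : Fin d, ∃ σ : ℤ, (σ = 1 ∨ σ = -1) ∧ u = Pi.single i σ ∧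
      normOne (p + (t : ℤ) • u) + (p i).natAbs = normOne p + (p i + t * σ).natAbs ∧
      normOne (p + u) + (p i).natAbs = normOne p + (p i + σ).natAbs := by
  obtain ⟨i, σ, hσ, hg⟩ := exists_eq_add_single_of_adj hu
  rw [add_sub_cancel_left] at hg
  refine ⟨i, σ, hσ, hg, ?_, ?_⟩
  · have h := normOne_add_natAbs_eq (e := p) (x := p + (t : ℤ) • u) (i := i)
      (fun k hk => by rw [hg]; simp [Pi.single_eq_of_ne hk])
    have hxi : (p + (t : ℤ) • u) i = p i + t * σ := by rw [hg]; simp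
    rwa [hxi] at h
  · have h := normOne_add_natAbs_eq (e := p) (x := p + u) (i := i)
      (fun k hk => by rw [hg]; simp [Pi.single_eq_of_ne hk])
    have hxi : (p + u) i = p i + σ := by rw [hg]; simp
    rwa [hxi] at h

/-- Two coordinates contribute at most the whole `ℓ¹`-norm. [cite: BDGS2012, §1.1, eq. (1.1)] -/
theorem natAbs_add_natAbs_le_normOne (e : Site d) {i j : Fin d} (hij : i ≠ j) :
    (e i).natAbs + (e j).natAbs ≤ normOne e := by
  classical
  unfold normOne
  calc (e i).natAbs + (e j).natAbs = ∑ k ∈ ({i, j} : Finset (Fin d)), (e k).natAbs :=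
        (Finset.sum_pair (f := fun k => (e k).natAbs) hij).symm
    _ ≤ ∑ k, (e k).natAbs :=
        Finset.sum_le_sum_of_subset_of_nonneg (Finset.subset_univ _) fun _ _ _ => Nat.zero_le _

open Classical in
/-- **No pocketed residual walk at an odd length `n ≤ 7d - 5`**: for `d ≥ 2`, `n` odd with
`n + 5 ≤ 7d`, every walk of the escape residual is trapped at BOTH ends (`extCount ω n = 0`).  See the
module docstring for the count (start cage, rays from the end through the other free neighbours, rays
out of the pocket site `y`); the three cases are short by `7d - 4 - n ≥ 1`.
[cite: MadrasSlade1993, §1.2, p. 10; §7.1] [cite: BDGS2012, §1.3] -/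
theorem extCount_eq_zero_of_mem_escapeResidual_of_odd (hd : 2 ≤ d) {n : ℕ} (hodd : Odd n)
    (hn : n + 5 ≤ 7 * d) {ω : ℕ → Site d} (hωR : ω ∈ escapeResidual d n) : extCount ω n = 0 := by
  classical
  by_contra hne0
  have ha1 : 1 ≤ extCount ω n := Nat.one_le_iff_ne_zero.2 hne0
  obtain ⟨hω, hdoom, hb⟩ := mem_escapeResidual.1 hωR
  obtain ⟨h00, -, hadj, hinj⟩ := mem_saws.1 hω
  have hn2 : n % 2 = 1 := Nat.odd_iff.1 hodd
  have hinj' : ∀ i ≤ n, ∀ j ≤ n, ω i = ω j → i = j := fun i hi j hj h =>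
    hinj (show i ∈ {i | i ≤ n} from hi) (show j ∈ {i | i ≤ n} from hj) h
  have hsum := exists_sum_apply_eq_add_two_mul hω
  -- the start-cage lemma
  have hcage := two_mul_le_card_exceptional_of_surrounded hω hodd hb
  set X := ((Finset.range n).filter fun i => i % 2 = 0).filter fun i =>
      ¬ (zdGraph d).Adj (ω n) (ω i) ∧ (normOne (ω i) = 0 ∨ normOne (ω i) = 2) with hX
  set e := ω n with he_def
  have he0 : e ≠ 0 := fun h => by
    have := hinj' n le_rfl 0 (Nat.zero_le n) (h.trans h00.symm); omega
  have hme1 : 1 ≤ normOne e := by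
    by_contra h; exact he0 (normOne_eq_zero_iff.1 (by omega))
  -- `‖e‖₁` is odd
  have hmodd : normOne e % 2 = 1 := by
    obtain ⟨m₁, hm₁⟩ := exists_normOne_eq_sum_add_two_mul e
    obtain ⟨m₂, hm₂⟩ := hsum n le_rfl
    rw [← he_def] at hm₂
    omega
  -- every neighbour of the start is visited
  have hvis0 : ∀ z, (zdGraph d).Adj 0 z → ∃ j ≤ n, ω j = z := by
    intro z hz
    have hU0 := (card_filter_nbrs_start_le_extCount_revWalk hω).trans hb.le
    by_contra h
    have : 0 < ((nbrs (ω 0)).filter fun z => ∀ i ≤ n, ω i ≠ z).card :=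
      Finset.card_pos.2 ⟨z, Finset.mem_filter.2 ⟨mem_nbrs.2 (by rw [h00]; exact hz),
        fun i hi hiz => h ⟨i, hi, hiz⟩⟩⟩
    omega
  -- odd and even walk sites
  set O := ((Finset.range (n + 1)).filter fun j => j % 2 = 1).image ω with hO
  set E := ((Finset.range (n + 1)).filter fun j => j % 2 = 0).image ω with hE
  have hOcard : O.card ≤ (n + 1) / 2 :=
    Finset.card_image_le.trans (by have := card_filter_range_odd_le (n + 1); omega)
  have hEcard : E.card ≤ (n + 1) / 2 :=
    Finset.card_image_le.trans (by have := card_filter_range_even_le (n + 1); omega)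
  have hOmem : ∀ j ≤ n, j % 2 = 1 → ω j ∈ O := fun j hj hpar =>
    Finset.mem_image.2 ⟨j, Finset.mem_filter.2 ⟨Finset.mem_range.2 (by omega), hpar⟩, rfl⟩
  have hEmem : ∀ j ≤ n, j % 2 = 0 → ω j ∈ E := fun j hj hpar =>
    Finset.mem_image.2 ⟨j, Finset.mem_filter.2 ⟨Finset.mem_range.2 (by omega), hpar⟩, rfl⟩
  set N0 := nbrs (0 : Site d) with hN0
  set A := (nbrs e).filter fun z => z ∈ visited ω n with hA
  have hAcard : A.card + extCount ω n = 2 * d := by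
    rw [extCount, freeNbrs, hA, Finset.card_filter_add_card_filter_not, card_nbrs]
  have hN0O : N0 ⊆ O := by
    intro z hz
    have hz' := mem_nbrs.1 hz
    obtain ⟨j, hj, rfl⟩ := hvis0 z hz'
    have hpar := odd_add_of_adj_apply_apply hω (Nat.zero_le n) hj (by rw [h00]; exact hz')
    exact hOmem j hj (by omega)
  have heO : e ∈ O := hOmem n le_rfl hn2
  have hAE : A ⊆ E := by
    intro z hz
    obtain ⟨hz, hzv⟩ := Finset.mem_filter.1 hz
    obtain ⟨j, hj, rfl⟩ := mem_visited.1 hzv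
    have hpar := odd_add_of_adj_apply hω hj (mem_nbrs.1 hz)
    exact hEmem j hj (by omega)
  have h0E : (0 : Site d) ∈ E := by rw [← h00]; exact hEmem 0 (Nat.zero_le _) rfl
  have hN0card : N0.card = 2 * d := card_nbrs _
  have hN0norm : ∀ z ∈ N0, normOne z = 1 := fun z hz => adj_zero_iff_normOne_eq_one.1 (mem_nbrs.1 hz)
  have h0A : (0 : Site d) ∈ A ↔ e ∈ N0 := by
    rw [hA, Finset.mem_filter, mem_nbrs, hN0, mem_nbrs]
    exact ⟨fun h => h.1.symm, fun h => ⟨h.symm, mem_visited.2 ⟨0, Nat.zero_le _, h00⟩⟩⟩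
  -- spare sites
  set S₁ := O \ insert e N0 with hS₁
  set S₀ := E \ insert (0 : Site d) A with hS₀
  have hS₁card : S₁.card + (insert e N0).card = O.card :=
    Finset.card_sdiff_add_card_eq_card (Finset.insert_subset heO hN0O)
  have hS₀card : S₀.card + (insert (0 : Site d) A).card = E.card :=
    Finset.card_sdiff_add_card_eq_card (Finset.insert_subset h0E hAE)
  have hS₁mem : ∀ x, x ∈ O → x ∉ N0 → x ≠ e → x ∈ S₁ := fun x h1 h2 h3 =>
    Finset.mem_sdiff.2 ⟨h1, by rw [Finset.mem_insert, not_or]; exact ⟨h3, h2⟩⟩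
  have hS₀mem : ∀ x, x ∈ E → x ≠ 0 → x ∉ A → x ∈ S₀ := fun x h1 h2 h3 =>
    Finset.mem_sdiff.2 ⟨h1, by rw [Finset.mem_insert, not_or]; exact ⟨h2, h3⟩⟩
  have hAadj : ∀ x ∈ A, (zdGraph d).Adj e x := fun x hx => mem_nbrs.1 (Finset.mem_filter.1 hx).1
  set N₂ := S₀.filter fun x => normOne x = 2 with hN₂
  set Far := S₀.filter fun x => 3 ≤ normOne x with hFar
  have hN2Far : N₂.card + Far.card ≤ S₀.card := by
    rw [hN₂, hFar, ← Finset.card_union_of_disjoint]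
    · exact Finset.card_le_card (Finset.union_subset (Finset.filter_subset _ _)
        (Finset.filter_subset _ _))
    · rw [Finset.disjoint_filter]; intro x _ h; omega
  -- (1) the exceptional times of the start cage carry `0` or norm-two spare even sites
  have hXinj : (X.image ω).card = X.card := by
    refine Finset.card_image_of_injOn fun i hi i' hi' h => ?_
    rw [Finset.mem_coe, hX, Finset.mem_filter, Finset.mem_filter, Finset.mem_range] at hi hi'
    exact hinj' i (by omega) i' (by omega) h
  have hXN₂ : X.card ≤ (insert (0 : Site d) N₂).card := by
    rw [← hXinj]
    refine Finset.card_le_card fun x hx => ?_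
    obtain ⟨i, hi, rfl⟩ := Finset.mem_image.1 hx
    rw [hX, Finset.mem_filter, Finset.mem_filter, Finset.mem_range] at hi
    obtain ⟨⟨hin, hpar⟩, hnadj, hnorm⟩ := hi
    rcases hnorm with h0 | h2
    · rw [normOne_eq_zero_iff.1 h0]; exact Finset.mem_insert_self _ _
    · refine Finset.mem_insert_of_mem (Finset.mem_filter.2 ⟨hS₀mem _ (hEmem i (by omega) hpar)
        (fun h => by rw [h, normOne_zero] at h2; omega) (fun h => hnadj (hAadj _ h)), h2⟩)
  have h0N₂ : (0 : Site d) ∉ N₂ := fun h => by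
    have := (Finset.mem_filter.1 h).2; rw [normOne_zero] at this; omega
  have hXle : X.card ≤ N₂.card + 1 := by
    rw [Finset.card_insert_of_notMem h0N₂] at hXN₂; exact hXN₂
  have hXle' : e ∈ N0 → X.card ≤ N₂.card := by
    intro heN
    rw [← hXinj]
    refine Finset.card_le_card fun x hx => ?_
    obtain ⟨i, hi, rfl⟩ := Finset.mem_image.1 hx
    rw [hX, Finset.mem_filter, Finset.mem_filter, Finset.mem_range] at hi
    obtain ⟨⟨hin, hpar⟩, hnadj, hnorm⟩ := hi
    have hi0 : ω i ≠ 0 := by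
      intro h
      have : i = 0 := hinj' i (by omega) 0 (Nat.zero_le n) (h.trans h00.symm)
      subst this
      exact hnadj (by rw [h00]; exact (mem_nbrs.1 heN).symm)
    rcases hnorm with h0 | h2
    · exact absurd (normOne_eq_zero_iff.1 h0) hi0
    · exact Finset.mem_filter.2 ⟨hS₀mem _ (hEmem i (by omega) hpar) hi0
        (fun h => hnadj (hAadj _ h)), h2⟩
  -- (2) the free neighbours of the end; choose the pocket site `y`
  set Fr := freeNbrs ω n with hFr
  have hFrE : ∀ y ∈ Fr, (zdGraph d).Adj e y ∧ ∀ i ≤ n, ω i ≠ y := fun y hy => mem_freeNbrs.1 hy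
  have hFrcard : Fr.card = extCount ω n := rfl
  have hFrne : Fr.Nonempty := Finset.card_pos.1 (by rw [hFrcard]; exact ha1)
  have hFrnorm : ∀ y ∈ Fr, 2 ≤ normOne y := by
    intro y hy
    obtain ⟨-, hyfree⟩ := hFrE y hy
    have h0 : normOne y ≠ 0 := fun h =>
      hyfree 0 (Nat.zero_le n) (h00.trans (normOne_eq_zero_iff.1 h).symm)
    have h1 : normOne y ≠ 1 := by
      intro h
      obtain ⟨k, hk, hky⟩ := hvis0 y (adj_zero_iff_normOne_eq_one.2 h)
      exact hyfree k hk hky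
    omega
  set CLe : Site d → Prop := fun y => ∃ t : ℕ, 2 ≤ t ∧ normOne (e + (t : ℤ) • (y - e)) ≤ 2
    with hCLe
  -- a costless direction is inward along a coordinate carrying almost all of `‖e‖₁`
  have hcle : ∀ y ∈ Fr, CLe y → ∃ i : Fin d, ∃ σ : ℤ, (σ = 1 ∨ σ = -1) ∧ y - e = Pi.single i σ ∧
      σ * e i < 0 ∧ 2 ≤ (e i).natAbs ∧ normOne e ≤ 2 + (e i).natAbs := by
    intro y hy ⟨t, ht, hcl⟩
    obtain ⟨hey, -⟩ := hFrE y hy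
    have hry := hFrnorm y hy
    have hey' : (zdGraph d).Adj e (e + (y - e)) := by rwa [add_sub_cancel]
    obtain ⟨i, σ, hσ, hu, hId, hId1⟩ := exists_single_of_ray hey' t
    rw [add_sub_cancel] at hId1
    refine ⟨i, σ, hσ, hu, ?_⟩
    rcases hσ with rfl | rfl <;> refine ⟨?_, ?_, ?_⟩ <;> omega
  have hcl1 : ∀ y₁ ∈ Fr, ∀ y₂ ∈ Fr, CLe y₁ → CLe y₂ → y₁ = y₂ := by
    intro y₁ hy₁ y₂ hy₂ hc₁ hc₂
    obtain ⟨i₁, σ₁, hσ₁, hg₁, hneg₁, htwo₁, hheavy₁⟩ := hcle y₁ hy₁ hc₁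
    obtain ⟨i₂, σ₂, hσ₂, hg₂, hneg₂, htwo₂, hheavy₂⟩ := hcle y₂ hy₂ hc₂
    by_cases hii : i₁ = i₂
    · subst hii
      have hs : σ₁ = σ₂ := by
        rcases hσ₁ with e1 | e1 <;> rcases hσ₂ with e2 | e2 <;>
          rw [e1] at hneg₁ ⊢ <;> rw [e2] at hneg₂ ⊢ <;> omega
      rw [hs, ← hg₂] at hg₁
      exact sub_left_injective hg₁
    · exfalso
      have := natAbs_add_natAbs_le_normOne e hii
      omega
  obtain ⟨y, hyFr, hychoice⟩ : ∃ y ∈ Fr, ∀ y' ∈ Fr, y' ≠ y → ¬ CLe y' := by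
    by_cases h : ∃ y ∈ Fr, CLe y
    · obtain ⟨y, hy, hcl⟩ := h
      exact ⟨y, hy, fun y' hy' hne hcl' => hne (hcl1 y' hy' y hy hcl' hcl)⟩
    · push Not at h
      obtain ⟨y, hy⟩ := hFrne
      exact ⟨y, hy, fun y' hy' _ => h y' hy'⟩
  obtain ⟨hey, hyfree⟩ := hFrE y hyFr
  obtain ⟨i₀, σ₀, hσ₀, hg₀⟩ := exists_eq_add_single_of_adj hey
  have hry : 2 ≤ normOne y := hFrnorm y hyFr
  have hy0 : y ≠ 0 := fun h => by rw [h, normOne_zero] at hry; omega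
  -- coordinate sum of `y`
  have hysum : (∑ k, y k) = (∑ k, e k) + σ₀ := by
    have : y = e + ((1 : ℕ) : ℤ) • (Pi.single i₀ σ₀ : Site d) := by
      rw [← hg₀]; push_cast; rw [one_smul, add_sub_cancel]
    rw [this, sum_apply_add_smul_single]; push_cast; ring
  -- (2b) every other free direction is costly and hands over a spare odd site away from `y`
  have hkeyE : ∀ y' ∈ Fr.erase y, ∃ x, x ∈ S₁.filter (fun x => ¬ (zdGraph d).Adj y x) ∧
      ∃ t : ℕ, 2 ≤ t ∧ (x = e + (t : ℤ) • (y' - e) ∨ (zdGraph d).Adj x (e + (t : ℤ) • (y' - e))) := by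
    intro y' hy'
    obtain ⟨hne, hy'Fr⟩ := Finset.mem_erase.1 hy'
    have hncl : ¬ CLe y' := hychoice y' hy'Fr hne
    obtain ⟨hey', hy'free⟩ := hFrE y' hy'Fr
    obtain ⟨i, σ, hσ, hg⟩ := exists_eq_add_single_of_adj hey'
    obtain ⟨t, ht, j, hj, hw⟩ := exists_ray_blocker hdoom hy'Fr
    set w := e + (t : ℤ) • (y' - e) with hw_def
    have hw3 : 3 ≤ normOne w := by
      by_contra h
      exact hncl ⟨t, ht, by rw [← hw_def]; omega⟩
    have hwe : normOne (w - e) = t := by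
      rw [hw_def, add_sub_cancel_left, hg]; exact normOne_natCast_smul_single hσ t
    have hgg : (Pi.single i σ : Site d) ≠ Pi.single i₀ σ₀ := by
      rw [← hg, ← hg₀]; exact fun h => hne (sub_left_injective h)
    -- `w` is far from `y`
    have hwy : normOne (w - y) = t + 1 := by
      have : w - y = (t : ℤ) • (Pi.single i σ : Site d) - ((1 : ℕ) : ℤ) • Pi.single i₀ σ₀ := by
        rw [hw_def, ← hg, ← hg₀]; push_cast; module
      rw [this]; exact normOne_smul_single_sub_smul_single hσ hσ₀ hgg t 1
    have hnoty : ∀ x, (x = w ∨ (zdGraph d).Adj x w) → ¬ (zdGraph d).Adj y x := by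
      intro x hx hyx
      rcases hx with rfl | hx
      · have := normOne_sub_eq_one_of_adj hyx; omega
      · have e1 : w - y = (w - x) + (x - y) := by abel
        have := normOne_add_le (w - x) (x - y)
        rw [← e1, hwy, normOne_sub_eq_one_of_adj hx, normOne_sub_eq_one_of_adj hyx] at this
        omega
    have hj0 : j ≠ 0 := by
      rintro rfl
      rw [h00] at hw
      rw [← hw, normOne_zero] at hw3
      omega
    have hjn : j ≠ n := by
      rintro rfl
      have : normOne (w - e) = 0 := by rw [← hw, sub_self, normOne_zero]
      omega
    have hpar : (j + 1 + t) % 2 = 0 := by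
      obtain ⟨m₁, hm₁⟩ := hsum j hj
      obtain ⟨m₂, hm₂⟩ := hsum n le_rfl
      have hs : (∑ k, ω j k) = (∑ k, e k) + t * σ := by
        rw [hw, hw_def, hg]; exact sum_apply_add_smul_single e i σ t
      rw [← he_def] at hm₂
      rw [hm₁, hm₂] at hs
      rcases hσ with rfl | rfl <;> omega
    have hwN0 : w ∉ N0 := fun h => by have := hN0norm w h; omega
    have hwne : w ≠ e := fun h => by
      have : normOne (w - e) = 0 := by rw [h, sub_self, normOne_zero]
      omega
    rcases Nat.even_or_odd t with ⟨r, hr⟩ | ⟨r, hr⟩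
    · -- `t` even: `w` is an odd site off the start cage
      have hjodd : j % 2 = 1 := by omega
      have hwO : w ∈ O := hw ▸ hOmem j hj hjodd
      exact ⟨w, Finset.mem_filter.2 ⟨hS₁mem w hwO hwN0 hwne, hnoty w (Or.inl rfl)⟩, t, ht, Or.inl rfl⟩
    · -- `t` odd: `w` sits at an even time `0 < j < n`, between two odd sites next to `w`
      have hjodd : (j - 1) % 2 = 1 ∧ (j + 1) % 2 = 1 := by omega
      have hjlt : j < n := lt_of_le_of_ne hj hjn
      set u := ω (j - 1) with hu
      set v := ω (j + 1) with hv
      have huO : u ∈ O := hOmem (j - 1) (by omega) hjodd.1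
      have hvO : v ∈ O := hOmem (j + 1) (by omega) hjodd.2
      have huw : (zdGraph d).Adj u w := by
        rw [← hw]; have := hadj (j - 1) (by omega); rwa [show j - 1 + 1 = j by omega] at this
      have hvw : (zdGraph d).Adj v w := by rw [← hw]; exact (hadj j hjlt).symm
      have huv : u ≠ v := fun h => by have := hinj' (j - 1) (by omega) (j + 1) (by omega) h; omega
      have hnot : ¬ (u ∈ N0 ∧ v ∈ N0) := by
        rintro ⟨huN, hvN⟩
        have hu0 := mem_nbrs.1 huN
        have hv0 := mem_nbrs.1 hvN
        rcases eq_or_eq_of_adj_adj huv hu0.symm hv0 huw hvw.symm with h | h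
        · rw [h, normOne_zero] at hw3; omega
        · rw [sub_zero] at h
          have := normOne_add_le u v
          rw [← h, hN0norm u huN, hN0norm v hvN] at this
          omega
      have hne_e : ∀ x, (zdGraph d).Adj x w → x ≠ e := by
        intro x hxw hxe
        rw [hxe] at hxw
        have := normOne_sub_eq_one_of_adj hxw
        omega
      by_cases huN : u ∈ N0
      · have hvN : v ∉ N0 := fun h => hnot ⟨huN, h⟩
        exact ⟨v, Finset.mem_filter.2 ⟨hS₁mem v hvO hvN (hne_e v hvw), hnoty v (Or.inr hvw)⟩,
          t, ht, Or.inr hvw⟩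
      · exact ⟨u, Finset.mem_filter.2 ⟨hS₁mem u huO huN (hne_e u huw), hnoty u (Or.inr huw)⟩,
          t, ht, Or.inr huw⟩
  choose! ψ hψS hψt using hkeyE
  set K := S₁.filter fun x => (zdGraph d).Adj y x with hK
  have hStep2 : (Fr.erase y).card + K.card ≤ S₁.card := by
    have h1 : (Fr.erase y).card ≤ (S₁.filter fun x => ¬ (zdGraph d).Adj y x).card := by
      refine Finset.card_le_card_of_injOn ψ (fun y' hy' => Finset.mem_coe.2 (hψS y' (Finset.mem_coe.1 hy'))) ?_
      intro y₁ hy₁ y₂ hy₂ hψ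
      rw [Finset.mem_coe] at hy₁ hy₂
      by_contra hne
      obtain ⟨hey₁, -⟩ := hFrE y₁ (Finset.mem_erase.1 hy₁).2
      obtain ⟨hey₂, -⟩ := hFrE y₂ (Finset.mem_erase.1 hy₂).2
      obtain ⟨i₁, σ₁, hσ₁, hg₁⟩ := exists_eq_add_single_of_adj hey₁
      obtain ⟨i₂, σ₂, hσ₂, hg₂⟩ := exists_eq_add_single_of_adj hey₂
      have hne' : (Pi.single i₁ σ₁ : Site d) ≠ Pi.single i₂ σ₂ := by
        rw [← hg₁, ← hg₂]; exact fun h => hne (sub_left_injective h)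
      obtain ⟨t₁, ht₁, h₁⟩ := hψt y₁ hy₁
      obtain ⟨t₂, ht₂, h₂⟩ := hψt y₂ hy₂
      rw [hg₁] at h₁
      rw [hg₂, ← hψ] at h₂
      exact ray_witness_separate hσ₁ hσ₂ hne' ht₁ ht₂ h₁ h₂
    have h2 := Finset.card_filter_add_card_filter_not (s := S₁) (fun x => (zdGraph d).Adj y x)
    rw [← hK] at h2
    omega
  have hFry : (Fr.erase y).card + 1 = Fr.card := Finset.card_erase_add_one hyFr
  -- (3) the neighbours of `y`: visited ones are odd sites, free ones are blocked directions
  set Vy := (nbrs y).filter fun z => z ∈ visited ω n with hVy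
  set FY := (nbrs y).filter fun z => z ∉ visited ω n with hFY
  have hVF : Vy.card + FY.card = 2 * d := by
    rw [hVy, hFY, Finset.card_filter_add_card_filter_not, card_nbrs]
  have hVyO : Vy ⊆ O := by
    intro z hz
    obtain ⟨hzy, hzv⟩ := Finset.mem_filter.1 hz
    obtain ⟨k, hk, rfl⟩ := mem_visited.1 hzv
    have hyz := mem_nbrs.1 hzy
    obtain ⟨m₁, hm₁⟩ := hsum k hk
    obtain ⟨m₂, hm₂⟩ := hsum n le_rfl
    rw [← he_def] at hm₂
    refine hOmem k hk ?_
    rcases sum_apply_eq_of_adj hyz with h | h <;> rw [hm₁, hysum, hm₂] at h <;>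
      rcases hσ₀ with e1 | e1 <;> rw [e1] at h <;> omega
  have hVysplit : Vy.card ≤ (Vy.filter fun z => z ∈ insert e N0).card + K.card := by
    have h := Finset.card_filter_add_card_filter_not (s := Vy) (fun z => z ∈ insert e N0)
    have h2 : (Vy.filter fun z => ¬ z ∈ insert e N0).card ≤ K.card := by
      refine Finset.card_le_card fun z hz => ?_
      obtain ⟨hzV, hzn⟩ := Finset.mem_filter.1 hz
      exact Finset.mem_filter.2 ⟨Finset.mem_sdiff.2 ⟨hVyO hzV, hzn⟩,
        mem_nbrs.1 (Finset.mem_filter.1 hzV).1⟩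
    omega
  set κ := (Vy.filter fun z => z ∈ insert e N0).card with hκ
  have hκ3 : κ ≤ 3 := by
    have hsub : (Vy.filter fun z => z ∈ insert e N0) ⊆
        insert e (N0.filter fun z => (zdGraph d).Adj 0 z ∧ (zdGraph d).Adj z y) := by
      intro z hz
      obtain ⟨hzV, hzin⟩ := Finset.mem_filter.1 hz
      rcases Finset.mem_insert.1 hzin with rfl | hzN
      · exact Finset.mem_insert_self _ _
      · exact Finset.mem_insert_of_mem (Finset.mem_filter.2
          ⟨hzN, mem_nbrs.1 hzN, (mem_nbrs.1 (Finset.mem_filter.1 hzV).1).symm⟩)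
    have h2 := card_filter_adj_adj_le_two hy0.symm N0
    exact (Finset.card_le_card hsub).trans ((Finset.card_insert_le _ _).trans (by omega))
  have hκ2 : e ∈ N0 → κ ≤ 2 := by
    intro heN
    have hsub : (Vy.filter fun z => z ∈ insert e N0) ⊆
        N0.filter fun z => (zdGraph d).Adj 0 z ∧ (zdGraph d).Adj z y := by
      intro z hz
      obtain ⟨hzV, hzin⟩ := Finset.mem_filter.1 hz
      have hzN : z ∈ N0 := by
        rcases Finset.mem_insert.1 hzin with rfl | h
        · exact heN
        · exact h
      exact Finset.mem_filter.2 ⟨hzN, mem_nbrs.1 hzN, (mem_nbrs.1 (Finset.mem_filter.1 hzV).1).symm⟩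
    exact (Finset.card_le_card hsub).trans (card_filter_adj_adj_le_two hy0.symm _)
  have hκ1 : 4 ≤ normOne y → κ ≤ 1 := by
    intro hr4
    have hsub : (Vy.filter fun z => z ∈ insert e N0) ⊆ {e} := by
      intro z hz
      obtain ⟨hzV, hzin⟩ := Finset.mem_filter.1 hz
      rcases Finset.mem_insert.1 hzin with rfl | hzN
      · exact Finset.mem_singleton_self _
      · exfalso
        have h1 := hN0norm z hzN
        rcases normOne_adj_cases (mem_nbrs.1 (Finset.mem_filter.1 hzV).1) with h | h <;> omega
    exact (Finset.card_le_card hsub).trans (Finset.card_singleton e).le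
  have hye2 : e ∈ N0 → normOne y ≤ 2 := by
    intro heN
    have h1 := hN0norm e heN
    rcases normOne_adj_cases hey with h | h <;> omega
  -- `‖y‖₁` is even
  have hyeven : normOne y % 2 = 0 := by
    obtain ⟨m₁, hm₁⟩ := exists_normOne_eq_sum_add_two_mul y
    obtain ⟨m₂, hm₂⟩ := hsum n le_rfl
    rw [← he_def] at hm₂
    rw [hysum, hm₂] at hm₁
    rcases hσ₀ with e1 | e1 <;> rw [e1] at hm₁ <;> omega
  -- free directions at `y`
  set CLy : Site d → Prop := fun z => ∃ t : ℕ, 2 ≤ t ∧ normOne (y + (t : ℤ) • (z - y)) ≤ 3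
    with hCLy
  set Cy := FY.filter fun z => CLy z with hCy
  set Dy := FY.filter fun z => ¬ CLy z with hDy
  have hCDy : Cy.card + Dy.card = FY.card := by
    rw [hCy, hDy, Finset.card_filter_add_card_filter_not]
  have hFYE : ∀ z ∈ FY, (zdGraph d).Adj y z ∧ ∀ i ≤ n, ω i ≠ z := fun z hz => by
    obtain ⟨hzy, hzv⟩ := Finset.mem_filter.1 hz
    exact ⟨mem_nbrs.1 hzy, fun i hi h => hzv (mem_visited.2 ⟨i, hi, h⟩)⟩
  have hσ₀' : (-σ₀ = 1 ∨ -σ₀ = -1) := by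
    rcases hσ₀ with h | h
    · right; omega
    · left; omega
  -- (3b) costly directions at `y` hand over far spare even sites
  have hkeyY : ∀ z ∈ Dy, ∃ x, x ∈ Far ∧ ∃ t : ℕ, 2 ≤ t ∧
      (x = y + (t : ℤ) • (z - y) ∨ (zdGraph d).Adj x (y + (t : ℤ) • (z - y))) := by
    intro z hzD
    obtain ⟨hzFY, hncl⟩ := Finset.mem_filter.1 hzD
    obtain ⟨hyz, hzfree⟩ := hFYE z hzFY
    obtain ⟨i, σ, hσ, hu⟩ := exists_eq_add_single_of_adj hyz
    have hyz' : (zdGraph d).Adj y (y + (z - y)) := by rwa [add_sub_cancel]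
    obtain ⟨t, ht, j, hj, hw⟩ := exists_free_ray_blocker hdoom hyFr hyz'
      (fun k hk => by rw [add_sub_cancel]; exact hzfree k hk)
    set w := y + (t : ℤ) • (z - y) with hw_def
    have hw4 : 4 ≤ normOne w := by
      by_contra h
      exact hncl ⟨t, ht, by rw [← hw_def]; omega⟩
    have hwy : normOne (w - y) = t := by
      rw [hw_def, add_sub_cancel_left, hu]; exact normOne_natCast_smul_single hσ t
    -- the direction is not back towards `e` (`z ≠ e`)
    have hug : (Pi.single i σ : Site d) ≠ Pi.single i₀ (-σ₀) := by
      intro h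
      have h1 : z - y = -(y - e) := by rw [hu, hg₀, h, Pi.single_neg]
      have hze : z = e := by linear_combination h1
      exact hzfree n le_rfl hze.symm
    have hwe : normOne (w - e) = t + 1 := by
      have : w - e = (t : ℤ) • (Pi.single i σ : Site d) - ((1 : ℕ) : ℤ) • Pi.single i₀ (-σ₀) := by
        rw [hw_def, hu, Pi.single_neg, ← hg₀]; push_cast; module
      rw [this]
      exact normOne_smul_single_sub_smul_single hσ hσ₀' hug t 1
    have hpar : (j + t) % 2 = 0 := by
      obtain ⟨m₁, hm₁⟩ := hsum j hj
      obtain ⟨m₂, hm₂⟩ := hsum n le_rfl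
      have hs : (∑ k, ω j k) = (∑ k, y k) + t * σ := by
        rw [hw, hw_def, hu]; exact sum_apply_add_smul_single y i σ t
      rw [← he_def] at hm₂
      rw [hm₁, hysum, hm₂] at hs
      rcases hσ with e1 | e1 <;> rcases hσ₀ with e2 | e2 <;> rw [e1, e2] at hs <;> omega
    have hnotA : ∀ x, (x = w ∨ (zdGraph d).Adj x w) → x ∉ A := by
      intro x hx hxA
      have hex := hAadj x hxA
      rcases hx with rfl | hx
      · have := normOne_sub_eq_one_of_adj hex; omega
      · have e1 : w - e = (w - x) + (x - e) := by abel
        have := normOne_add_le (w - x) (x - e)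
        rw [← e1, hwe, normOne_sub_eq_one_of_adj hx, normOne_sub_eq_one_of_adj hex] at this
        omega
    have hfar3 : ∀ x, (zdGraph d).Adj x w → 3 ≤ normOne x := by
      intro x hx
      rcases normOne_adj_cases hx with h | h <;> omega
    rcases Nat.even_or_odd t with ⟨r, hr⟩ | ⟨r, hr⟩
    · -- `t` even: `w` is an even site, far and off the end cage
      have hjev : j % 2 = 0 := by omega
      have hwE : w ∈ E := hw ▸ hEmem j hj hjev
      have hw0 : w ≠ 0 := fun h => by rw [h, normOne_zero] at hw4; omega
      exact ⟨w, Finset.mem_filter.2 ⟨hS₀mem w hwE hw0 (hnotA w (Or.inl rfl)), by omega⟩, t, ht,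
        Or.inl rfl⟩
    · -- `t` odd: `w` sits at an odd time `j < n`; its successor is a far even site next to `w`
      have hjodd : j % 2 = 1 := by omega
      have hjn : j ≠ n := by
        rintro rfl
        have : normOne (w - e) = 0 := by rw [← hw, sub_self, normOne_zero]
        omega
      have hjlt : j < n := lt_of_le_of_ne hj hjn
      set v := ω (j + 1) with hv
      have hvE : v ∈ E := hEmem (j + 1) (by omega) (by omega)
      have hvw : (zdGraph d).Adj v w := by rw [← hw]; exact (hadj j hjlt).symm
      have hv3 := hfar3 v hvw
      have hv0 : v ≠ 0 := fun h => by rw [h, normOne_zero] at hv3; omega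
      exact ⟨v, Finset.mem_filter.2 ⟨hS₀mem v hvE hv0 (hnotA v (Or.inr hvw)), hv3⟩, t, ht,
        Or.inr hvw⟩
  choose! χ hχF hχt using hkeyY
  have hDyFar : Dy.card ≤ Far.card := by
    refine Finset.card_le_card_of_injOn χ
      (fun z hz => Finset.mem_coe.2 (hχF z (Finset.mem_coe.1 hz))) ?_
    intro z₁ hz₁ z₂ hz₂ hχ
    rw [Finset.mem_coe] at hz₁ hz₂
    by_contra hne
    obtain ⟨hyz₁, -⟩ := hFYE z₁ (Finset.mem_filter.1 hz₁).1
    obtain ⟨hyz₂, -⟩ := hFYE z₂ (Finset.mem_filter.1 hz₂).1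
    obtain ⟨i₁, σ₁, hσ₁, hg₁⟩ := exists_eq_add_single_of_adj hyz₁
    obtain ⟨i₂, σ₂, hσ₂, hg₂⟩ := exists_eq_add_single_of_adj hyz₂
    have hne' : (Pi.single i₁ σ₁ : Site d) ≠ Pi.single i₂ σ₂ := by
      rw [← hg₁, ← hg₂]; exact fun h => hne (sub_left_injective h)
    obtain ⟨t₁, ht₁, h₁⟩ := hχt z₁ hz₁
    obtain ⟨t₂, ht₂, h₂⟩ := hχt z₂ hz₂
    rw [hg₁] at h₁
    rw [hg₂, ← hχ] at h₂
    exact ray_witness_separate hσ₁ hσ₂ hne' ht₁ ht₂ h₁ h₂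
  -- (3c) costless directions at `y`: at most two, none unless `‖y‖₁ ≥ 4`
  have hcly : ∀ z ∈ Cy, ∃ i : Fin d, ∃ σ : ℤ, (σ = 1 ∨ σ = -1) ∧ z - y = Pi.single i σ ∧
      σ * y i < 0 ∧ 2 ≤ (y i).natAbs ∧ normOne y ≤ 3 + (y i).natAbs ∧ 4 ≤ normOne y := by
    intro z hz
    obtain ⟨hzFY, t, ht, hcl⟩ := Finset.mem_filter.1 hz
    obtain ⟨hyz, hzfree⟩ := hFYE z hzFY
    have hyz' : (zdGraph d).Adj y (y + (z - y)) := by rwa [add_sub_cancel]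
    obtain ⟨i, σ, hσ, hu, hId, hId1⟩ := exists_single_of_ray hyz' t
    rw [add_sub_cancel] at hId1
    have hz2 : 2 ≤ normOne z := by
      have h0 : normOne z ≠ 0 := fun h =>
        hzfree 0 (Nat.zero_le n) (h00.trans (normOne_eq_zero_iff.1 h).symm)
      have h1 : normOne z ≠ 1 := by
        intro h
        obtain ⟨k, hk, hkz⟩ := hvis0 z (adj_zero_iff_normOne_eq_one.2 h)
        exact hzfree k hk hkz
      omega
    refine ⟨i, σ, hσ, hu, ?_⟩
    rcases hσ with rfl | rfl <;> refine ⟨?_, ?_, ?_, ?_⟩ <;> omega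
  have hd1 : 1 ≤ d := by omega
  haveI : Nonempty (Fin d) := ⟨⟨0, hd1⟩⟩
  choose! ax sg hsg hax hneg htwo hheavy hfour using hcly
  set Iy := (Finset.univ : Finset (Fin d)).filter
    fun i => 2 ≤ (y i).natAbs ∧ normOne y ≤ 3 + (y i).natAbs with hIy
  have hCyI : Cy.card ≤ Iy.card := by
    refine Finset.card_le_card_of_injOn ax (fun z hz => ?_) ?_
    · have hz := Finset.mem_coe.1 hz
      exact Finset.mem_coe.2 (Finset.mem_filter.2 ⟨Finset.mem_univ _, htwo z hz, hheavy z hz⟩)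
    · intro z₁ hz₁ z₂ hz₂ h
      rw [Finset.mem_coe] at hz₁ hz₂
      have h1 := hneg z₁ hz₁
      have h2 := hneg z₂ hz₂
      rw [h] at h1
      have hs : sg z₁ = sg z₂ := by
        rcases hsg z₁ hz₁ with e1 | e1 <;> rcases hsg z₂ hz₂ with e2 | e2 <;>
          rw [e1] at h1 ⊢ <;> rw [e2] at h2 ⊢ <;> omega
      have := hax z₁ hz₁
      rw [h, hs, ← hax z₂ hz₂] at this
      exact sub_left_injective this
  have hIy2 : Iy.card ≤ 2 := by
    by_contra h3
    have hsumI : ∑ i ∈ Iy, (y i).natAbs ≤ normOne y :=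
      Finset.sum_le_sum_of_subset_of_nonneg (Finset.filter_subset _ _) fun _ _ _ => Nat.zero_le _
    have h2I : Iy.card • 2 ≤ ∑ i ∈ Iy, (y i).natAbs :=
      Finset.card_nsmul_le_sum Iy _ 2 fun i hi => (Finset.mem_filter.1 hi).2.1
    have hmI : Iy.card • (normOne y - 3) ≤ ∑ i ∈ Iy, (y i).natAbs :=
      Finset.card_nsmul_le_sum Iy _ _ fun i hi => by
        have := (Finset.mem_filter.1 hi).2.2; omega
    rw [smul_eq_mul] at h2I hmI
    have h3' : 3 ≤ Iy.card := by omega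
    have : 3 * (normOne y - 3) ≤ normOne y :=
      (Nat.mul_le_mul_right _ h3').trans (hmI.trans hsumI)
    have : 3 * 2 ≤ normOne y := (Nat.mul_le_mul_right _ h3').trans (h2I.trans hsumI)
    omega
  have hCy0 : normOne y ≤ 3 → Cy.card = 0 := by
    intro h
    rw [Finset.card_eq_zero, Finset.eq_empty_iff_forall_notMem]
    intro z hz
    have := hfour z hz
    omega
  -- (4) the final count
  by_cases heN : e ∈ N0
  · have hins : (insert e N0).card = 2 * d := by rw [Finset.card_insert_of_mem heN, hN0card]
    have hinsA : (insert (0 : Site d) A).card = A.card := Finset.card_insert_of_mem (h0A.2 heN)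
    have hr2 := hye2 heN
    have hC0 := hCy0 (by omega)
    have hκ' := hκ2 heN
    have hXq := hXle' heN
    omega
  · have hins : (insert e N0).card = 2 * d + 1 := by
      rw [Finset.card_insert_of_notMem heN, hN0card]
    have hinsA : (insert (0 : Site d) A).card = A.card + 1 :=
      Finset.card_insert_of_notMem (fun h => heN (h0A.1 h))
    by_cases hr : normOne y ≤ 3
    · have hC0 := hCy0 hr
      omega
    · have hκ' := hκ1 (by omega)
      omega

/-! ### O'Brien's inequality for all `n ≤ 6d - 2`; the threshold law of the escape residual -/

/-- **`R(d, n) = ∅` for every odd `n ≤ 6d - 3`, in every dimension `d ≥ 2`**: a residual walk would be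
pocketed by `SAWCountMonotoneBothTrappedOdd.lean` and both-trapped by
`extCount_eq_zero_of_mem_escapeResidual_of_odd`. [cite: MadrasSlade1993, §7.1] [cite: BDGS2012, §1.3] -/
theorem escapeResidual_eq_empty_of_odd (hd : 2 ≤ d) {n : ℕ} (hodd : Odd n) (hn : n + 3 ≤ 6 * d) :
    escapeResidual d n = ∅ := by
  refine Finset.eq_empty_of_forall_notMem fun ω hωR => ?_
  have h1 := one_le_extCount_of_mem_escapeResidual_of_odd hodd hn hωR
  have h0 := extCount_eq_zero_of_mem_escapeResidual_of_odd hd hodd (by omega) hωR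
  omega

/-- **`cₙ ≤ cₙ₊₁` for every odd `n ≤ 6d - 3`, in every dimension `d ≥ 2`**, by the escape route
(`d = 3`: `n = 15`; `d = 4`: `n = 21` — the odd lengths beyond the tree's `n ≤ 6d - 4`).
[cite: BDGS2012, §1.3] [cite: MadrasSlade1993, §7.1] -/
theorem count_le_count_succ_of_odd_le (hd : 2 ≤ d) {n : ℕ} (hodd : Odd n) (hn : n + 3 ≤ 6 * d) :
    count d n ≤ count d (n + 1) :=
  count_le_count_succ_of_escapeResidual_eq_empty (escapeResidual_eq_empty_of_odd hd hodd hn)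

/-- **`cₙ ≤ cₙ₊₁` for ALL `n ≤ 6d - 2`, in every dimension `d ≥ 1`**: odd `n ≤ 6d - 3` by
`count_le_count_succ_of_odd_le`, even `n ≤ 6d - 2 ≤ 8d - 6` by `count_le_count_succ_of_even_le`
(`SAWCountMonotoneEscapeEven.lean`), `d = 1` by `count_one_le_count_one_succ`.  (`d = 2`: `n ≤ 10`;
`d = 3`: `n ≤ 16` and the even `18`; `d = 4`: `n ≤ 22` and the even `24, 26`.)  This supersedes
`count_le_count_succ_of_le_six_mul` (`n ≤ 6d - 4`); the general inequality is O'Brien's theorem, the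
tree's named fact `BDGS2012_count_mono`. [cite: BDGS2012, §1.3] [cite: MadrasSlade1993, §7.1] -/
theorem count_le_count_succ_of_le_six_mul_sub_two {n : ℕ} (hd : 1 ≤ d) (hn : n + 2 ≤ 6 * d) :
    count d n ≤ count d (n + 1) := by
  rcases Nat.lt_or_ge d 2 with hd1 | hd2
  · obtain rfl : d = 1 := by omega
    exact count_one_le_count_one_succ n
  rcases Nat.even_or_odd n with hev | hodd
  · exact count_le_count_succ_of_even_le hev (by omega)
  · exact count_le_count_succ_of_odd_le hd2 hodd (by obtain ⟨k, rfl⟩ := hodd; omega)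

/-- **The threshold law of the escape residual** (every `d ≥ 2`): `R(d, n) = ∅` iff `n` is odd with
`n ≤ 6d - 3` or even with `n ≤ 8d - 6` — the emptiness halves are `escapeResidual_eq_empty_of_odd` and
`escapeResidual_eq_empty_of_even`, the witnesses beyond are `escapeResidual_nonempty_of_odd`
(`SAWCountMonotoneEscapeSharp.lean`) and `escapeResidual_nonempty_of_even`
(`SAWCountMonotoneEscapeSharpEven.lean`).  So the escape route proves O'Brien's inequality EXACTLY at
the lengths `n ≤ 6d - 2` and the even `n ≤ 8d - 6`. [cite: BDGS2012, §1.3] [cite: MadrasSlade1993, §7.1] -/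
theorem escapeResidual_eq_empty_iff (hd : 2 ≤ d) {n : ℕ} :
    escapeResidual d n = ∅ ↔ (Odd n ∧ n + 3 ≤ 6 * d) ∨ (Even n ∧ n + 6 ≤ 8 * d) := by
  constructor
  · intro h
    rcases Nat.even_or_odd n with hev | hodd
    · refine Or.inr ⟨hev, ?_⟩
      by_contra hlt
      have hne := escapeResidual_nonempty_of_even hd hev (by obtain ⟨k, rfl⟩ := hev; omega)
      rw [h] at hne
      exact Finset.not_nonempty_empty hne
    · refine Or.inl ⟨hodd, ?_⟩
      by_contra hlt
      have hne := escapeResidual_nonempty_of_odd hd hodd (by obtain ⟨k, rfl⟩ := hodd; omega)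
      rw [h] at hne
      exact Finset.not_nonempty_empty hne
  · rintro (⟨hodd, hn⟩ | ⟨hev, hn⟩)
    · exact escapeResidual_eq_empty_of_odd hd hodd hn
    · exact escapeResidual_eq_empty_of_even hev hn

/-- The threshold law, nonempty form: `R(d, n) ≠ ∅` iff `n` is odd with `n ≥ 6d - 1` or even with
`n ≥ 8d - 4` (`d ≥ 2`). [cite: BDGS2012, §1.3] -/
theorem escapeResidual_nonempty_iff (hd : 2 ≤ d) {n : ℕ} :
    (escapeResidual d n).Nonempty ↔ (Odd n ∧ 6 * d ≤ n + 1) ∨ (Even n ∧ 8 * d ≤ n + 4) := by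
  constructor
  · intro h
    have hne : escapeResidual d n ≠ ∅ := Finset.nonempty_iff_ne_empty.1 h
    rcases Nat.even_or_odd n with hev | hodd
    · refine Or.inr ⟨hev, ?_⟩
      by_contra hlt
      exact hne (escapeResidual_eq_empty_of_even hev (by obtain ⟨k, rfl⟩ := hev; omega))
    · refine Or.inl ⟨hodd, ?_⟩
      by_contra hlt
      exact hne (escapeResidual_eq_empty_of_odd hd hodd (by obtain ⟨k, rfl⟩ := hodd; omega))
  · rintro (⟨hodd, hn⟩ | ⟨hev, hn⟩)
    · exact escapeResidual_nonempty_of_odd hd hodd hn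
    · exact escapeResidual_nonempty_of_even hd hev hn

end Literature.Probability.RandomPlanarGeometry.SAW.Zd
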